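import Literature.Analysis.Calculus.WeightedTameComposition
import Literature.NumberTheory.Automorphic.ResGLnHermitianConeOpen
import HarnessLib

/-!
# The entry gauge on the hermitian cone of `Res_{K/ℚ} GL_n` and tame translated cut-offs

Topic `NumberTheory/Automorphic`; namespace `Literature.NumberTheory.Automorphic` (grouping
sub-namespace `ResGLnCone` for the statements about the cone).  Theorems only (no definition, no
named fact).

On the cone `X = posCone n K` of positive hermitian matrices over `K_∞ = mixedSpace K`
(`Literature/NumberTheory/Automorphic/ResGLnHermitianCone.lean`), Borel's partitions of unity for an
arithmetic group `Γ` are built from a smooth cut-off `χ` of a Siegel-reduced set whose first two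
derivatives are bounded polynomially in the ENTRY GAUGE
`E(H) = 1 + ∑_{i,j} (‖H i j‖ + ‖(H⁻¹) i j‖)` (`SiegelReducedFamiliesCutoff.lean`), translated by
finitely many rational matrices and clamped.  This file supplies the two elementary inputs:

* `sum_norm_mul_apply_le`, `entryGauge_conj_le` — the entry sum `∑ ‖M i j‖` of a square matrix over
  a normed ring is submultiplicative and `ᴴ`-invariant, whence
  `E(g x gᴴ) ≤ (1 + (∑‖g i j‖)² + (∑‖g⁻¹ i j‖)²) E(x)` (`(g x gᴴ)⁻¹ = g⁻¹ᴴ x⁻¹ g⁻¹`);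
  `ResGLnCone.entryGauge_coneActionRat_le` — hence `E(A · x) ≤ C_A E(x)` for the cone action
  `A · x = θ(A) x θ(A)ᴴ` of a rational `A` (`ResGLnCone.coneActionRat`);
* `ResGLnCone.tame_smoothTransition_sum_translate` — if `χ` is tame on the cone for a weight `B ≥ 1`
  growing at most polynomially under the cone action (e.g. `B = E`), then so is
  `y ↦ θ(∑_{t ∈ T} χ((t⁻¹ A) · y))` for `θ = Real.smoothTransition`, a finite `T ⊆ GL_n(K)` and
  `A ∈ GL_n(K)` (tameness = `C^∞` with polynomially weighted bounds on the derivatives of order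
  `≤ 2`, `Literature/Analysis/Calculus/WeightedTameFunctions.lean` and `…Composition.lean`).

Not here: the cut-off itself, reduction theory, the partition of unity (problem-side files).

## References

* A. Borel, *Introduction aux groupes arithmétiques*, Hermann 1969, §12. [Borel1969]
* A. Borel, *Regularization theorems in Lie algebra cohomology. Applications*, Duke Math. J. 50
  (1983), §3.5.  The estimates themselves are folklore.
-/

noncomputable section

open scoped Matrix ContDiff Classical
open Set NumberField NumberField.mixedEmbedding Literature.Analysis.Calculus

namespace Literature.NumberTheory.Automorphic

/-! ### The entry sum of a square matrix -/

section Mat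

variable {m : Type*} [Fintype m] {R : Type*} [NormedRing R]

/-- **The entry sum is submultiplicative**: `∑ ‖(A B) i j‖ ≤ (∑ ‖A i j‖)(∑ ‖B i j‖)`. [folklore] -/
theorem sum_norm_mul_apply_le (A B : Matrix m m R) :
    ∑ i, ∑ j, ‖(A * B) i j‖ ≤ (∑ i, ∑ j, ‖A i j‖) * ∑ i, ∑ j, ‖B i j‖ := by
  have hrow : ∀ l, ∑ j, ‖B l j‖ ≤ ∑ i, ∑ j, ‖B i j‖ := fun l =>
    Finset.single_le_sum (f := fun i => ∑ j, ‖B i j‖)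
      (fun _ _ => Finset.sum_nonneg fun _ _ => norm_nonneg _) (Finset.mem_univ l)
  calc ∑ i, ∑ j, ‖(A * B) i j‖ ≤ ∑ i, ∑ j, ∑ l, ‖A i l‖ * ‖B l j‖ := by
        gcongr with i _ j _
        rw [Matrix.mul_apply]
        exact (norm_sum_le _ _).trans (Finset.sum_le_sum fun l _ => norm_mul_le _ _)
    _ = ∑ i, ∑ l, ‖A i l‖ * ∑ j, ‖B l j‖ := by
        simp_rw [Finset.mul_sum]
        exact Finset.sum_congr rfl fun _ _ => Finset.sum_comm
    _ ≤ ∑ i, ∑ l, ‖A i l‖ * ∑ i', ∑ j, ‖B i' j‖ := Finset.sum_le_sum fun i _ =>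
        Finset.sum_le_sum fun l _ => mul_le_mul_of_nonneg_left (hrow l) (norm_nonneg _)
    _ = (∑ i, ∑ l, ‖A i l‖) * ∑ i', ∑ j, ‖B i' j‖ := by simp_rw [Finset.sum_mul]

/-- The entry sum is invariant under the conjugate transpose. [folklore] -/
theorem sum_norm_conjTranspose_apply [StarRing R] [NormedStarGroup R] (A : Matrix m m R) :
    ∑ i, ∑ j, ‖Aᴴ i j‖ = ∑ i, ∑ j, ‖A i j‖ := by
  rw [Finset.sum_comm]
  exact Finset.sum_congr rfl fun i _ => Finset.sum_congr rfl fun j _ => norm_star _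

/-- **The entry gauge under conjugation**: for square matrices `g, x` over a commutative normed
`⋆`-ring, `1 + ∑‖(g x gᴴ) i j‖ + ∑‖(g x gᴴ)⁻¹ i j‖ ≤ (1 + (∑‖g i j‖)² + (∑‖g⁻¹ i j‖)²) ·
(1 + ∑‖x i j‖ + ∑‖x⁻¹ i j‖)` (submultiplicativity, `ᴴ`-invariance, `(g x gᴴ)⁻¹ = g⁻¹ᴴ x⁻¹ g⁻¹`).
[folklore] -/
theorem entryGauge_conj_le {R : Type*} [NormedCommRing R] [StarRing R] [NormedStarGroup R]
    [DecidableEq m] (g x : Matrix m m R) :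
    1 + (∑ i, ∑ j, ‖(g * x * gᴴ) i j‖) + ∑ i, ∑ j, ‖(g * x * gᴴ)⁻¹ i j‖ ≤
      (1 + (∑ i, ∑ j, ‖g i j‖) ^ 2 + (∑ i, ∑ j, ‖g⁻¹ i j‖) ^ 2) *
        (1 + (∑ i, ∑ j, ‖x i j‖) + ∑ i, ∑ j, ‖x⁻¹ i j‖) := by
  have hnn : ∀ M : Matrix m m R, 0 ≤ ∑ i, ∑ j, ‖M i j‖ := fun M =>
    Finset.sum_nonneg fun _ _ => Finset.sum_nonneg fun _ _ => norm_nonneg _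
  have hP := hnn x
  have hQ := hnn x⁻¹
  have ha2 : 0 ≤ (∑ i, ∑ j, ‖g i j‖) ^ 2 := sq_nonneg _
  have hb2 : 0 ≤ (∑ i, ∑ j, ‖g⁻¹ i j‖) ^ 2 := sq_nonneg _
  have h1 : ∑ i, ∑ j, ‖(g * x * gᴴ) i j‖ ≤ (∑ i, ∑ j, ‖g i j‖) ^ 2 * ∑ i, ∑ j, ‖x i j‖ := by
    have h := (sum_norm_mul_apply_le (g * x) gᴴ).trans
      (mul_le_mul_of_nonneg_right (sum_norm_mul_apply_le g x) (hnn _))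
    rw [sum_norm_conjTranspose_apply] at h
    exact h.trans (le_of_eq (by ring))
  have h2 : ∑ i, ∑ j, ‖(g * x * gᴴ)⁻¹ i j‖ ≤
      (∑ i, ∑ j, ‖g⁻¹ i j‖) ^ 2 * ∑ i, ∑ j, ‖x⁻¹ i j‖ := by
    rw [Matrix.mul_inv_rev, Matrix.mul_inv_rev, ← Matrix.conjTranspose_nonsing_inv]
    have h := (sum_norm_mul_apply_le g⁻¹ᴴ (x⁻¹ * g⁻¹)).trans
      (mul_le_mul_of_nonneg_left (sum_norm_mul_apply_le x⁻¹ g⁻¹) (hnn _))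
    rw [sum_norm_conjTranspose_apply] at h
    exact h.trans (le_of_eq (by ring))
  nlinarith [mul_nonneg ha2 hQ, mul_nonneg hb2 hP, h1, h2]

end Mat

/-! ### The cone: the entry gauge under translation, tame translated cut-offs -/

namespace ResGLnCone

variable {n : ℕ} {K : Type} [Field K] [NumberField K]

/-- The cone action is multiplicative on points: `A · (B · x) = (A B) · x`. [folklore] -/
theorem coneActionRat_coneActionRat (A B : GL (Fin n) K) (x : hermSpace n K) :
    coneActionRat n K A (coneActionRat n K B x) = coneActionRat n K (A * B) x := by
  rw [map_mul]
  rfl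

/-- **The entry gauge under a fixed rational translation**: `E(A · x) ≤ C_A E(x)` for
`E(H) = 1 + ∑ (‖H i j‖ + ‖H⁻¹ i j‖)` (`entryGauge_conj_le` with `g = θ(A)`). [cite: Borel1969, §12] -/
theorem entryGauge_coneActionRat_le (A : GL (Fin n) K) :
    ∃ C : ℝ, 0 ≤ C ∧ ∀ x : hermSpace n K,
      (1 + ∑ i, ∑ j, (‖(coneActionRat n K A x).1 i j‖ + ‖(coneActionRat n K A x).1⁻¹ i j‖)) ≤
        C * (1 + ∑ i, ∑ j, (‖x.1 i j‖ + ‖x.1⁻¹ i j‖)) := by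
  refine ⟨1 + (∑ i, ∑ j, ‖(toMixedGL n K A).1 i j‖) ^ 2 +
    (∑ i, ∑ j, ‖(toMixedGL n K A).1⁻¹ i j‖) ^ 2, by positivity, fun x => ?_⟩
  simp only [Finset.sum_add_distrib, ← add_assoc]
  rw [coneActionRat_apply, coe_coneAction]
  exact entryGauge_conj_le _ _

/-- **Tame translated, symmetrised and clamped cut-offs.**  If `χ` is tame on the cone for a
weight `B ≥ 1` which grows at most polynomially under the cone action of every rational matrix,
then for a finite `T ⊆ GL_n(K)` and `A ∈ GL_n(K)` the function `y ↦ θ(∑_{t ∈ T} χ((t⁻¹ A) · y))`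
(`θ = Real.smoothTransition`) is tame on the cone for `B` (precomposition with the linear maps
`(t⁻¹ A) ·`, finite sum, smooth clamp). [folklore] -/
theorem tame_smoothTransition_sum_translate (B : hermSpace n K → ℝ)
    (hB : ∀ x ∈ posCone n K, 1 ≤ B x)
    (hBA : ∀ A : GL (Fin n) K, ∃ (C : ℝ) (k : ℕ), ∀ x ∈ posCone n K,
      B (coneActionRat n K A x) ≤ C * B x ^ k)
    {χ : hermSpace n K → ℝ}
    (hχ : ContDiffOn ℝ ∞ χ (posCone n K) ∧ ∃ (C : ℝ) (k : ℕ), ∀ x ∈ posCone n K, ∀ i ≤ 2,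
      ‖iteratedFDerivWithin ℝ i χ (posCone n K) x‖ ≤ C * B x ^ k)
    (T : Finset (GL (Fin n) K)) (A : GL (Fin n) K) :
    ContDiffOn ℝ ∞ (fun y => Real.smoothTransition (∑ t ∈ T, χ (coneActionRat n K (t⁻¹ * A) y)))
        (posCone n K) ∧
      ∃ (C : ℝ) (k : ℕ), ∀ x ∈ posCone n K, ∀ i ≤ 2,
        ‖iteratedFDerivWithin ℝ i
          (fun y => Real.smoothTransition (∑ t ∈ T, χ (coneActionRat n K (t⁻¹ * A) y)))
          (posCone n K) x‖ ≤ C * B x ^ k := by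
  have hU : IsOpen (posCone n K) := isOpen_posCone n K
  refine tame_smoothTransition hU hB (tame_finset_sum hU hB T fun t _ => ?_)
  obtain ⟨C, k, hC⟩ := hBA (t⁻¹ * A)
  exact tame_comp_clm_right hU hB (coneActionRat n K (t⁻¹ * A))
    (mapsTo_coneActionRat_posCone n K _) hC hχ

end ResGLnCone

end Literature.NumberTheory.Automorphic
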